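import Literature.Computability.QuantumComplexity.PhaseFrobenius
import Mathlib.NumberTheory.Zsqrtd.GaussianInt
import HarnessLib

/-!
# Gaussian-integer matrices at dyadic scale (numerics of the effective compiler, II)

Second file of the effective (exponential-time, polynomial-accuracy) gate compiler behind the
named fact `PromiseBQPOver_eq_PromiseBQP`. The compiler is an integer program: a complex matrix on
the `m`-qubit register is stored as a matrix of Gaussian integers `X : GMat m` at precision `p`,
standing for `hat p X = X / 2ᵖ`. This file proves what the compiler's arithmetic does to the
represented matrices, in the Frobenius / phase-invariant metric of `PhaseFrobenius.lean`:

* `cplx`, `hat`, `fro_hat`, `hat_scaledOne` (`2ᵖ • 1` represents `1`);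
* **rounded products** `roundMul p A X = ⌊A X / 2ᵖ⌋` (componentwise floor division `rdiv`):
  `‖hat (roundMul p A X) - hat A · hat X‖_F ≤ 2 · 2ᵐ / 2ᵖ` (`fro_hat_roundMul_sub_le`), and the
  **error recurrence** `fro_hat_roundMul_sub_mul_le`: if `hat A` is within `η` of a unitary `a` and
  `hat X` within `e` of a unitary `M`, the rounded product is within `e + (2ᵐ + e) η + 2 · 2ᵐ / 2ᵖ`
  of `a M` (Nielsen–Chuang's chaining of errors, Box 4.1, plus rounding);
* **clamping** `clampMat B` (entrywise saturation, inactive under `EntryBound B`, which a Frobenius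
  bound on the represented matrix provides: `entryBound_of_fro_hat_le`) — this is what keeps the
  program's registers polynomially bounded on arbitrary data;
* **the exact closeness test** `closeTest p T X Y` deciding `D(hat X, hat Y) ≤ 1/T` in integer
  arithmetic (`closeTest_eq_true_iff`): with `n = T²(‖X‖² + ‖Y‖²) - 4ᵖ` it is
  `n ≤ 0 ∨ n² ≤ 4 T⁴ |⟨X, Y⟩|²` (`froSqZ`, `finnerZ` are the integer Frobenius data;
  `phaseDistSq_hat`);
* **packing by grid cells** (`cell`, `cellBox`, `length_le_of_pairwise_far`): matrices with entries
  bounded by `B` that are pairwise `≥ 2 · 2ᵐ · h` apart in Frobenius norm have pairwise distinct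
  cells at mesh `h`, all in a box of `(2B/h + 1)^{2·4ᵐ}` cells — the counting step bounding the
  size of an `ε`-net of `U(2ᵐ)` (Dawson–Nielsen 2006, §5, here in the crude cube form, which is
  all polynomiality needs).

Everything is proved; no named facts.

## References

* C. M. Dawson, M. A. Nielsen, *The Solovay–Kitaev algorithm*, Quantum Inf. Comput. 6 (2006),
  §5 (the initial `ε`-net and its size) [DawsonNielsen2006].
* M. A. Nielsen, I. L. Chuang, *Quantum Computation and Quantum Information*, CUP 2010, §4.5.3
  Box 4.1 (chaining of approximation errors) [NielsenChuang2010].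
* E. Bernstein, U. Vazirani, *Quantum complexity theory*, SIAM J. Comput. 26 (1997), §6
  (dyadic approximation of amplitudes) [BernsteinVazirani1997].
-/

noncomputable section

namespace Literature.Computability.QuantumComplexity

open Matrix Cryptography PhaseFrobenius GaussianInt

namespace NetCompiler

variable {m : ℕ}

/-! ### Gaussian-integer matrices and the complex matrices they represent -/

/-- Matrices on the `m`-qubit register with Gaussian-integer entries: the data type of the
compiler (an entry `z` at precision `p` stands for the complex number `z / 2ᵖ`). [folklore] -/
abbrev GMat (m : ℕ) : Type := Matrix (QReg m) (QReg m) GaussianInt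

/-- The complex matrix with the same (Gaussian-integer) entries. [folklore] -/
def cplx (X : GMat m) : Matrix (QReg m) (QReg m) ℂ := X.map toComplex

/-- **The represented matrix at precision `p`**: `X / 2ᵖ`. [folklore] -/
def hat (p : ℕ) (X : GMat m) : Matrix (QReg m) (QReg m) ℂ := ((2 : ℂ) ^ p)⁻¹ • cplx X

/-- Entries of `cplx`. [folklore] -/
@[simp] theorem cplx_apply (X : GMat m) (i j : QReg m) : cplx X i j = toComplex (X i j) := rfl

/-- `cplx` is multiplicative. [folklore] -/
theorem cplx_mul (X Y : GMat m) : cplx (X * Y) = cplx X * cplx Y := Matrix.map_mul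

/-- `cplx` is additive. [folklore] -/
theorem cplx_add (X Y : GMat m) : cplx (X + Y) = cplx X + cplx Y := Matrix.map_add toComplex (map_add toComplex) X Y

/-- `cplx` commutes with subtraction. [folklore] -/
theorem cplx_sub (X Y : GMat m) : cplx (X - Y) = cplx X - cplx Y := Matrix.map_sub toComplex (map_sub toComplex) X Y

/-- `cplx 1 = 1`. [folklore] -/
@[simp] theorem cplx_one : cplx (1 : GMat m) = 1 := by
  rw [cplx, Matrix.map_one _ (map_zero _) (map_one _)]

/-- `cplx (n • X) = n • cplx X` for a natural scalar. [folklore] -/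
theorem cplx_natCast_smul (n : ℕ) (X : GMat m) : cplx ((n : GaussianInt) • X) = (n : ℂ) • cplx X := by
  ext i j
  simp [cplx, Matrix.smul_apply]

/-- The scale `2ᵖ` is positive. [folklore] -/
theorem two_pow_pos' (p : ℕ) : (0 : ℝ) < 2 ^ p := by positivity

/-- `‖(2^p : ℂ)⁻¹‖ = 2⁻ᵖ`. [folklore] -/
theorem norm_inv_two_pow (p : ℕ) : ‖((2 : ℂ) ^ p)⁻¹‖ = ((2 : ℝ) ^ p)⁻¹ := by
  rw [norm_inv, norm_pow]; norm_num

/-- `‖hat p X‖_F = ‖cplx X‖_F / 2ᵖ`. [folklore] -/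
theorem fro_hat (p : ℕ) (X : GMat m) : fro (hat p X) = fro (cplx X) / 2 ^ p := by
  rw [hat, fro_smul, norm_inv_two_pow, inv_mul_eq_div]

/-- `hat` is additive up to the common scale. [folklore] -/
theorem hat_sub (p : ℕ) (X Y : GMat m) : hat p X - hat p Y = ((2 : ℂ) ^ p)⁻¹ • (cplx X - cplx Y) := by
  rw [hat, hat, smul_sub]

/-- `‖hat p X - hat p Y‖_F = ‖cplx X - cplx Y‖_F / 2ᵖ`. [folklore] -/
theorem fro_hat_sub (p : ℕ) (X Y : GMat m) : fro (hat p X - hat p Y) = fro (cplx X - cplx Y) / 2 ^ p := by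
  rw [hat_sub, fro_smul, norm_inv_two_pow, inv_mul_eq_div]

/-- **The scaled identity represents the identity**: `hat p (2ᵖ • 1) = 1`. [folklore] -/
theorem hat_scaledOne (p : ℕ) : hat p (((2 ^ p : ℕ) : GaussianInt) • (1 : GMat m)) = 1 := by
  rw [hat, cplx_natCast_smul, cplx_one, smul_smul]
  have h : ((2 : ℂ) ^ p)⁻¹ * ((2 ^ p : ℕ) : ℂ) = 1 := by
    push_cast; exact inv_mul_cancel₀ (pow_ne_zero _ two_ne_zero)
  rw [h, one_smul]

/-! ### Rounded products -/

/-- Floor division of a Gaussian integer by `2ᵖ`, componentwise. [folklore] -/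
def rdiv (p : ℕ) (z : GaussianInt) : GaussianInt := ⟨z.re / 2 ^ p, z.im / 2 ^ p⟩

/-- **The rounded product** `⌊A X / 2ᵖ⌋` (componentwise floor): at precision `p` it represents
`hat p A * hat p X` up to rounding. [folklore] -/
def roundMul (p : ℕ) (A X : GMat m) : GMat m := (A * X).map (rdiv p)

/-- Floor division is within `1` of exact division. [folklore] -/
theorem abs_ediv_sub_div_le (a : ℤ) {d : ℤ} (hd : 0 < d) : |((a / d : ℤ) : ℝ) - (a : ℝ) / d| ≤ 1 := by
  have h1 : (a / d : ℤ) * d ≤ a := Int.ediv_mul_le a hd.ne'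
  have h2 : a < (a / d + 1) * d := Int.lt_ediv_add_one_mul_self a hd
  have hdR : (0 : ℝ) < d := by exact_mod_cast hd
  have h1R : ((a / d : ℤ) : ℝ) * d ≤ a := by exact_mod_cast h1
  have h2R : (a : ℝ) < ((a / d : ℤ) + 1) * d := by exact_mod_cast h2
  rw [abs_le]
  constructor
  · have : (a : ℝ) / d < (a / d : ℤ) + 1 := by rw [div_lt_iff₀ hdR]; exact h2R
    linarith
  · have : ((a / d : ℤ) : ℝ) ≤ (a : ℝ) / d := by rw [le_div_iff₀ hdR]; exact h1R
    linarith

/-- **Rounding error of one entry**: `|rdiv p z - z / 2ᵖ| ≤ 2` (indeed `≤ √2`). [folklore] -/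
theorem norm_toComplex_rdiv_sub_le (p : ℕ) (z : GaussianInt) :
    ‖toComplex (rdiv p z) - ((2 : ℂ) ^ p)⁻¹ * toComplex z‖ ≤ 2 := by
  have hd : (0 : ℤ) < 2 ^ p := by positivity
  have hre := abs_ediv_sub_div_le z.re hd
  have him := abs_ediv_sub_div_le z.im hd
  have hc : ((2 : ℂ) ^ p)⁻¹ = ((((2 : ℝ) ^ p)⁻¹ : ℝ) : ℂ) := by push_cast; rfl
  set w : ℂ := toComplex (rdiv p z) - ((2 : ℂ) ^ p)⁻¹ * toComplex z with hw
  have hwre : w.re = ((z.re / 2 ^ p : ℤ) : ℝ) - (z.re : ℝ) / (2 ^ p : ℤ) := by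
    rw [hw, hc, Complex.sub_re, Complex.re_ofReal_mul, toComplex_def₂, toComplex_def₂]
    simp [rdiv, div_eq_inv_mul]
  have hwim : w.im = ((z.im / 2 ^ p : ℤ) : ℝ) - (z.im : ℝ) / (2 ^ p : ℤ) := by
    rw [hw, hc, Complex.sub_im, Complex.im_ofReal_mul, toComplex_def₂, toComplex_def₂]
    simp [rdiv, div_eq_inv_mul]
  calc ‖w‖ ≤ |w.re| + |w.im| := Complex.norm_le_abs_re_add_abs_im w
    _ ≤ 1 + 1 := by rw [hwre, hwim]; exact add_le_add hre him
    _ = 2 := by norm_num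

/-- **Rounding error of the rounded product**:
`‖hat p (roundMul p A X) - hat p A * hat p X‖_F ≤ 2 · 2ᵐ / 2ᵖ`. [folklore] -/
theorem fro_hat_roundMul_sub_le (p : ℕ) (A X : GMat m) :
    fro (hat p (roundMul p A X) - hat p A * hat p X) ≤ 2 * Fintype.card (QReg m) / 2 ^ p := by
  have hfac : hat p (roundMul p A X) - hat p A * hat p X =
      ((2 : ℂ) ^ p)⁻¹ • (cplx (roundMul p A X) - ((2 : ℂ) ^ p)⁻¹ • cplx (A * X)) := by
    rw [hat, hat, hat, cplx_mul, Matrix.smul_mul, Matrix.mul_smul, smul_sub, smul_smul]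
  rw [hfac, fro_smul, norm_inv_two_pow]
  have hent : ∀ i j, ‖(cplx (roundMul p A X) - ((2 : ℂ) ^ p)⁻¹ • cplx (A * X)) i j‖ ≤ 2 := fun i j => by
    simp only [Matrix.sub_apply, Matrix.smul_apply, cplx_apply, roundMul, Matrix.map_apply, smul_eq_mul]
    exact norm_toComplex_rdiv_sub_le p _
  have h := fro_le_card_mul _ zero_le_two hent
  calc ((2 : ℝ) ^ p)⁻¹ * fro (cplx (roundMul p A X) - ((2 : ℂ) ^ p)⁻¹ • cplx (A * X))
      ≤ ((2 : ℝ) ^ p)⁻¹ * (Fintype.card (QReg m) * 2) := by gcongr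
    _ = 2 * Fintype.card (QReg m) / 2 ^ p := by ring

/-- **One step of the error recurrence.** If `hat p A` is within `η` of a unitary `a`, and
`hat p X` is within `e` of a unitary `M`, then the rounded product represents `a M` within
`e + (2ᵐ + e) η + 2 · 2ᵐ / 2ᵖ`. [cite: NielsenChuang2010, §4.5.3 Box 4.1 (chaining of errors)] -/
theorem fro_hat_roundMul_sub_mul_le (p : ℕ) {A X : GMat m} {a M : Matrix (QReg m) (QReg m) ℂ}
    (ha : a ∈ Matrix.unitaryGroup (QReg m) ℂ) (hM : M ∈ Matrix.unitaryGroup (QReg m) ℂ) {η e : ℝ}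
    (hA : fro (hat p A - a) ≤ η) (hX : fro (hat p X - M) ≤ e) :
    fro (hat p (roundMul p A X) - a * M) ≤
      e + (Fintype.card (QReg m) + e) * η + 2 * Fintype.card (QReg m) / 2 ^ p := by
  have hη : 0 ≤ η := (fro_nonneg _).trans hA
  have he : 0 ≤ e := (fro_nonneg _).trans hX
  have h1 := fro_hat_roundMul_sub_le p A X
  have h2 : fro (hat p A * hat p X - a * hat p X) ≤ (Fintype.card (QReg m) + e) * η := by
    rw [← Matrix.sub_mul]
    refine (fro_mul_le _ _).trans ?_
    rw [mul_comm]
    refine mul_le_mul ?_ hA (fro_nonneg _) (by positivity)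
    calc fro (hat p X) ≤ fro (hat p X - M) + fro M := fro_le_fro_sub_add _ _
      _ ≤ e + Fintype.card (QReg m) := add_le_add hX (fro_le_card_of_mem_unitaryGroup hM)
      _ = Fintype.card (QReg m) + e := add_comm _ _
  have h3 : fro (a * hat p X - a * M) ≤ e := by
    rw [← Matrix.mul_sub, fro_unitary_mul ha]; exact hX
  calc fro (hat p (roundMul p A X) - a * M)
      ≤ fro (hat p (roundMul p A X) - hat p A * hat p X) + fro (hat p A * hat p X - a * M) := fro_sub_le _ _ _
    _ ≤ fro (hat p (roundMul p A X) - hat p A * hat p X) +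
        (fro (hat p A * hat p X - a * hat p X) + fro (a * hat p X - a * M)) := by
        gcongr; exact fro_sub_le _ _ _
    _ ≤ 2 * Fintype.card (QReg m) / 2 ^ p + ((Fintype.card (QReg m) + e) * η + e) := by gcongr
    _ = e + (Fintype.card (QReg m) + e) * η + 2 * Fintype.card (QReg m) / 2 ^ p := by ring


/-! ### Bounded entries and clamping -/

/-- Saturation of an integer at `±B`. [folklore] -/
def clampZ (B a : ℤ) : ℤ := max (-B) (min B a)

/-- Componentwise saturation of a Gaussian integer. [folklore] -/
def clampG (B : ℤ) (z : GaussianInt) : GaussianInt := ⟨clampZ B z.re, clampZ B z.im⟩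

/-- **Entrywise saturation of a matrix** at `±B` (inactive on the compiler's genuine data, it
keeps every register polynomially bounded whatever the data). [folklore] -/
def clampMat (B : ℤ) (X : GMat m) : GMat m := X.map (clampG B)

/-- Saturation does nothing within the bounds. [folklore] -/
theorem clampZ_of_abs_le {B a : ℤ} (h : |a| ≤ B) : clampZ B a = a := by
  rw [abs_le] at h; unfold clampZ; omega

/-- Saturated values are within the bounds. [folklore] -/
theorem abs_clampZ_le {B : ℤ} (hB : 0 ≤ B) (a : ℤ) : |clampZ B a| ≤ B := by
  rw [abs_le]; unfold clampZ; omega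

/-- A matrix has **entries bounded by `B`** (both components of every entry). [folklore] -/
def EntryBound (B : ℤ) (X : GMat m) : Prop := ∀ i j, |(X i j).re| ≤ B ∧ |(X i j).im| ≤ B

/-- Clamping does nothing to a matrix with bounded entries. [folklore] -/
theorem clampMat_of_entryBound {B : ℤ} {X : GMat m} (h : EntryBound B X) : clampMat B X = X := by
  ext i j
  · simp [clampMat, clampG, clampZ_of_abs_le (h i j).1]
  · simp [clampMat, clampG, clampZ_of_abs_le (h i j).2]

/-- A clamped matrix has bounded entries. [folklore] -/
theorem entryBound_clampMat {B : ℤ} (hB : 0 ≤ B) (X : GMat m) : EntryBound B (clampMat B X) := fun i j =>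
  ⟨by simpa [clampMat, clampG] using abs_clampZ_le hB (X i j).re,
   by simpa [clampMat, clampG] using abs_clampZ_le hB (X i j).im⟩

/-- The components of a Gaussian integer are bounded by its complex modulus. [folklore] -/
theorem abs_re_le_norm_toComplex (z : GaussianInt) : (|z.re| : ℝ) ≤ ‖toComplex z‖ := by
  have h := Complex.abs_re_le_norm (toComplex z)
  rw [toComplex_def₂] at h ⊢
  simpa using h

/-- The components of a Gaussian integer are bounded by its complex modulus. [folklore] -/
theorem abs_im_le_norm_toComplex (z : GaussianInt) : (|z.im| : ℝ) ≤ ‖toComplex z‖ := by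
  have h := Complex.abs_im_le_norm (toComplex z)
  rw [toComplex_def₂] at h ⊢
  simpa using h

/-- **A Frobenius bound on the represented matrix bounds the integer entries**: if
`‖hat p X‖_F ≤ r` and `r · 2ᵖ ≤ B` then `X` has entries bounded by `B`. [folklore] -/
theorem entryBound_of_fro_hat_le {p : ℕ} {X : GMat m} {r : ℝ} {B : ℤ} (h : fro (hat p X) ≤ r)
    (hB : r * 2 ^ p ≤ B) : EntryBound B X := by
  have hc : fro (cplx X) ≤ r * 2 ^ p := by
    rw [fro_hat, div_le_iff₀ (two_pow_pos' p)] at h; exact h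
  intro i j
  have hij : ‖toComplex (X i j)‖ ≤ (B : ℝ) := ((norm_apply_le_fro (cplx X) i j).trans hc).trans hB
  constructor
  · exact_mod_cast (abs_re_le_norm_toComplex (X i j)).trans hij
  · exact_mod_cast (abs_im_le_norm_toComplex (X i j)).trans hij

/-! ### The exact phase-distance test -/

/-- `∑ᵢⱼ |Xᵢⱼ|²` as an integer (`Zsqrtd.norm z = re² + im²` for Gaussian integers). [folklore] -/
def froSqZ (X : GMat m) : ℤ := ∑ i, ∑ j, (X i j).norm

/-- The Hilbert–Schmidt inner product as a Gaussian integer. [folklore] -/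
def finnerZ (X Y : GMat m) : GaussianInt := ∑ i, ∑ j, star (X i j) * Y i j

/-- The integer `T² (‖X‖² + ‖Y‖²) - 4ᵖ` of the test. [folklore] -/
def closeNum (p T : ℕ) (X Y : GMat m) : ℤ := (T : ℤ) ^ 2 * (froSqZ X + froSqZ Y) - 4 ^ p

/-- **The exact test `D(hat p X, hat p Y) ≤ 1/T`** in integer arithmetic:
`Φ ≤ 1/T²` iff `n ≤ 2 T² |⟨X, Y⟩|` for `n = T²(‖X‖² + ‖Y‖²) - 4ᵖ`, iff `n ≤ 0 ∨ n² ≤ 4 T⁴ |⟨X, Y⟩|²`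
(`closeTest_eq_true_iff`). [folklore] -/
def closeTest (p T : ℕ) (X Y : GMat m) : Bool :=
  decide (closeNum p T X Y ≤ 0 ∨ closeNum p T X Y ^ 2 ≤ 4 * (T : ℤ) ^ 4 * (finnerZ X Y).norm)

/-- `froSqZ` is the squared Frobenius norm. [folklore] -/
theorem froSqZ_cast (X : GMat m) : (froSqZ X : ℝ) = fro (cplx X) ^ 2 := by
  rw [fro_sq, froSqZ]
  push_cast
  refine Finset.sum_congr rfl fun i _ => Finset.sum_congr rfl fun j _ => ?_
  rw [intCast_real_norm, Complex.normSq_eq_norm_sq, cplx_apply]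

/-- `froSqZ ≥ 0`. [folklore] -/
theorem froSqZ_nonneg (X : GMat m) : 0 ≤ froSqZ X :=
  Finset.sum_nonneg fun _ _ => Finset.sum_nonneg fun _ _ => GaussianInt.norm_nonneg _

/-- `finnerZ` is the Hilbert–Schmidt inner product. [folklore] -/
theorem toComplex_finnerZ (X Y : GMat m) : toComplex (finnerZ X Y) = finner (cplx X) (cplx Y) := by
  rw [finner_eq_sum, finnerZ, map_sum]
  refine Finset.sum_congr rfl fun i _ => ?_
  rw [map_sum]
  refine Finset.sum_congr rfl fun j _ => ?_
  rw [map_mul, toComplex_star, cplx_apply, cplx_apply]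

/-- `|⟨X, Y⟩|²` as an integer. [folklore] -/
theorem norm_finnerZ_cast (X Y : GMat m) : ((finnerZ X Y).norm : ℝ) = ‖finner (cplx X) (cplx Y)‖ ^ 2 := by
  rw [intCast_real_norm, toComplex_finnerZ, Complex.normSq_eq_norm_sq]

/-- Scaling the inner product: `⟨cX, cY⟩ = |c|² ⟨X, Y⟩` in modulus. [folklore] -/
theorem norm_finner_smul (c : ℂ) (X Y : Matrix (QReg m) (QReg m) ℂ) :
    ‖finner (c • X) (c • Y)‖ = ‖c‖ ^ 2 * ‖finner X Y‖ := by
  rw [finner, finner, vecOf_smul, vecOf_smul, inner_smul_left, inner_smul_right, norm_mul, norm_mul,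
    Complex.norm_conj]
  ring

/-- **The squared phase distance of represented matrices** in terms of the integer data. [folklore] -/
theorem phaseDistSq_hat (p : ℕ) (X Y : GMat m) :
    phaseDistSq (hat p X) (hat p Y) =
      ((froSqZ X : ℝ) + froSqZ Y - 2 * Real.sqrt ((finnerZ X Y).norm : ℝ)) / 4 ^ p := by
  rw [phaseDistSq, fro_hat, fro_hat, hat, hat, norm_finner_smul, norm_inv_two_pow, froSqZ_cast, froSqZ_cast,
    norm_finnerZ_cast, Real.sqrt_sq (norm_nonneg _)]
  have h4 : (4 : ℝ) ^ p = (2 ^ p) ^ 2 := by rw [← pow_mul, mul_comm, pow_mul]; norm_num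
  rw [h4]
  field_simp

/-- **Correctness of the exact test**: for `T ≥ 1`, `closeTest p T X Y = true` iff
`D(hat p X, hat p Y) ≤ 1/T`. [folklore] -/
theorem closeTest_eq_true_iff {p T : ℕ} (hT : 0 < T) (X Y : GMat m) :
    closeTest p T X Y = true ↔ phaseDist (hat p X) (hat p Y) ≤ 1 / T := by
  have hT' : (0 : ℝ) < T := by exact_mod_cast hT
  rw [phaseDist_le_iff_sq_le (by positivity), phaseDistSq_hat, closeTest, decide_eq_true_iff]
  set N : ℝ := Real.sqrt ((finnerZ X Y).norm : ℝ) with hN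
  have hNn : 0 ≤ N := Real.sqrt_nonneg _
  have hNsq : N ^ 2 = ((finnerZ X Y).norm : ℝ) := Real.sq_sqrt (by exact_mod_cast GaussianInt.norm_nonneg _)
  set n : ℤ := closeNum p T X Y with hn
  have hncast : (n : ℝ) = (T : ℝ) ^ 2 * (froSqZ X + froSqZ Y) - 4 ^ p := by rw [hn, closeNum]; push_cast; ring
  -- the real form of the threshold inequality
  have key : ((froSqZ X : ℝ) + froSqZ Y - 2 * N) / 4 ^ p ≤ (1 / (T : ℝ)) ^ 2 ↔ (n : ℝ) ≤ 2 * T ^ 2 * N := by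
    rw [div_le_iff₀ (by positivity : (0 : ℝ) < 4 ^ p), one_div, inv_pow, inv_mul_eq_div,
      le_div_iff₀ (by positivity : (0 : ℝ) < (T : ℝ) ^ 2), hncast]
    have e : ((froSqZ X : ℝ) + froSqZ Y - 2 * N) * (T : ℝ) ^ 2 =
        (T : ℝ) ^ 2 * (froSqZ X + froSqZ Y) - 2 * T ^ 2 * N := by ring
    rw [e]
    constructor <;> intro h <;> linarith
  rw [key]
  have hsq : (2 * (T : ℝ) ^ 2 * N) ^ 2 = ((4 * (T : ℤ) ^ 4 * (finnerZ X Y).norm : ℤ) : ℝ) := by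
    push_cast; rw [← hNsq]; ring
  have h2N : 0 ≤ 2 * (T : ℝ) ^ 2 * N := by positivity
  constructor
  · rintro (h | h)
    · exact le_trans (by exact_mod_cast h) h2N
    · by_cases hn0 : (n : ℝ) ≤ 0
      · exact hn0.trans h2N
      · push Not at hn0
        have h' : (n : ℝ) ^ 2 ≤ (2 * (T : ℝ) ^ 2 * N) ^ 2 := by rw [hsq]; exact_mod_cast h
        exact le_of_pow_le_pow_left₀ two_ne_zero h2N h'
  · intro h
    by_cases hn0 : n ≤ 0
    · exact Or.inl hn0
    · right
      push Not at hn0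
      have hn0' : (0 : ℝ) ≤ n := by exact_mod_cast hn0.le
      have h' : (n : ℝ) ^ 2 ≤ (2 * (T : ℝ) ^ 2 * N) ^ 2 := pow_le_pow_left₀ hn0' h 2
      rw [hsq] at h'
      exact_mod_cast h'


/-- `closeTest` is reflexive-true: `D(X, X) = 0 ≤ 1/T`. [folklore] -/
theorem closeTest_self {p T : ℕ} (hT : 0 < T) (X : GMat m) : closeTest p T X X = true := by
  rw [closeTest_eq_true_iff hT, phaseDist_self]; positivity

/-! ### Grid cells: pairwise far matrices with bounded entries are few -/

/-- **The grid cell** of a matrix with entries bounded by `B`, at mesh `h`: componentwise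
`⌊(x + B)/h⌋` (shifted to be nonnegative). [cite: DawsonNielsen2006, §5 (counting the net)] -/
def cell (B : ℤ) (h : ℕ) (X : GMat m) : QReg m → QReg m → ℤ × ℤ :=
  fun i j => (((X i j).re + B) / h, ((X i j).im + B) / h)

/-- Integers with the same quotient are less than the divisor apart. [folklore] -/
theorem abs_sub_lt_of_ediv_eq {a b h : ℤ} (hh : 0 < h) (he : a / h = b / h) : |a - b| < h := by
  have ha1 := Int.ediv_mul_le a hh.ne'
  have ha2 := Int.lt_ediv_add_one_mul_self a hh
  have hb1 := Int.ediv_mul_le b hh.ne'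
  have hb2 := Int.lt_ediv_add_one_mul_self b hh
  rw [he] at ha1 ha2
  rw [abs_lt]
  constructor <;> nlinarith

/-- **Matrices in the same cell are close**: `‖cplx X - cplx Y‖_F < 2 · 2ᵐ · h`. [folklore] -/
theorem fro_lt_of_cell_eq {B : ℤ} {h : ℕ} (hh : 0 < h) {X Y : GMat m} (hc : cell B h X = cell B h Y) :
    fro (cplx X - cplx Y) < 2 * Fintype.card (QReg m) * h := by
  have hh' : (0 : ℤ) < h := by exact_mod_cast hh
  have hent : ∀ i j, ‖(cplx X - cplx Y) i j‖ ≤ 2 * h - 2 := fun i j => by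
    have hij := congrFun (congrFun hc i) j
    simp only [cell, Prod.mk.injEq] at hij
    have hre : |(X i j).re - (Y i j).re| < h := by
      have := abs_sub_lt_of_ediv_eq hh' hij.1; rwa [add_sub_add_right_eq_sub] at this
    have him : |(X i j).im - (Y i j).im| < h := by
      have := abs_sub_lt_of_ediv_eq hh' hij.2; rwa [add_sub_add_right_eq_sub] at this
    have hre' : |(X i j).re - (Y i j).re| ≤ h - 1 := by omega
    have him' : |(X i j).im - (Y i j).im| ≤ h - 1 := by omega
    rw [Matrix.sub_apply, cplx_apply, cplx_apply, ← map_sub]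
    refine (Complex.norm_le_abs_re_add_abs_im _).trans ?_
    rw [toComplex_def₂]
    have h1 : (|((X i j - Y i j).re : ℝ)|) ≤ (h : ℝ) - 1 := by
      rw [Zsqrtd.re_sub]; exact_mod_cast hre'
    have h2 : (|((X i j - Y i j).im : ℝ)|) ≤ (h : ℝ) - 1 := by
      rw [Zsqrtd.im_sub]; exact_mod_cast him'
    simp only
    linarith
  have hpos : (0 : ℝ) < Fintype.card (QReg m) := by exact_mod_cast Fintype.card_pos
  rcases le_or_gt (2 * (h : ℝ) - 2) 0 with hle | hgt
  · -- `h = 1`: all entries coincide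
    have h0 : ∀ i j, ‖(cplx X - cplx Y) i j‖ ≤ 0 := fun i j => (hent i j).trans hle
    have := fro_le_card_mul _ le_rfl h0
    have hh1 : (1 : ℝ) ≤ h := by exact_mod_cast hh
    nlinarith
  · have := fro_le_card_mul _ hgt.le hent
    nlinarith

/-- **Far matrices lie in different cells.** [folklore] -/
theorem cell_ne_of_le_fro {B : ℤ} {h : ℕ} (hh : 0 < h) {X Y : GMat m}
    (hfar : 2 * (Fintype.card (QReg m) : ℝ) * h ≤ fro (cplx X - cplx Y)) : cell B h X ≠ cell B h Y :=
  fun hc => absurd (fro_lt_of_cell_eq hh hc) (not_lt.2 hfar)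

/-- The range of cell components for entries bounded by `B`: `0, …, 2B/h`. [folklore] -/
def cellRange (B : ℤ) (h : ℕ) : Finset ℤ := Finset.Icc 0 (2 * B / h)

/-- The finite box containing the cells of matrices with entries bounded by `B`. [folklore] -/
def cellBox (m : ℕ) (B : ℤ) (h : ℕ) : Finset (QReg m → QReg m → ℤ × ℤ) :=
  Fintype.piFinset fun _ => Fintype.piFinset fun _ => cellRange B h ×ˢ cellRange B h

/-- A bounded component lands in the cell range. [folklore] -/
theorem mem_cellRange {B : ℤ} {h : ℕ} (hh : 0 < h) {a : ℤ} (ha : |a| ≤ B) : (a + B) / h ∈ cellRange B h := by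
  rw [abs_le] at ha
  have hh' : (0 : ℤ) < h := by exact_mod_cast hh
  rw [cellRange, Finset.mem_Icc]
  exact ⟨Int.ediv_nonneg (by omega) hh'.le, Int.ediv_le_ediv hh' (by omega)⟩

/-- The cell of a matrix with bounded entries lies in the box. [folklore] -/
theorem cell_mem_cellBox {B : ℤ} {h : ℕ} (hh : 0 < h) {X : GMat m} (hX : EntryBound B X) :
    cell B h X ∈ cellBox m B h := by
  simp only [cellBox, Fintype.mem_piFinset, Finset.mem_product]
  exact fun i j => ⟨mem_cellRange hh (hX i j).1, mem_cellRange hh (hX i j).2⟩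

/-- The size of the box: `(2B/h + 1)^{2 · 4ᵐ}`. [folklore] -/
theorem card_cellBox (B : ℤ) (h : ℕ) (hB : 0 ≤ B) :
    (cellBox m B h).card = ((2 * B / h).toNat + 1) ^ (2 * (Fintype.card (QReg m) * Fintype.card (QReg m))) := by
  have hr : (cellRange B h).card = (2 * B / h).toNat + 1 := by
    rw [cellRange, Int.card_Icc, sub_zero]
    have h0 : 0 ≤ 2 * B / h := Int.ediv_nonneg (by omega) (by exact_mod_cast Nat.zero_le h)
    omega
  simp only [cellBox, Fintype.card_piFinset, Finset.card_product, hr, Finset.prod_const, Finset.card_univ]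
  rw [← pow_mul, ← sq, ← pow_mul]

/-- **Packing.** A list of matrices with entries bounded by `B` that are pairwise at Frobenius
distance `≥ 2 · 2ᵐ · h` (as represented integer matrices) has at most `(2B/h + 1)^{2·4ᵐ}` members:
their cells are distinct members of the box. [cite: DawsonNielsen2006, §5 (counting the net)] -/
theorem length_le_of_pairwise_far {B : ℤ} (hB : 0 ≤ B) {h : ℕ} (hh : 0 < h) {l : List (GMat m)}
    (hbd : ∀ X ∈ l, EntryBound B X)
    (hfar : l.Pairwise fun X Y => 2 * (Fintype.card (QReg m) : ℝ) * h ≤ fro (cplx X - cplx Y)) :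
    l.length ≤ ((2 * B / h).toNat + 1) ^ (2 * (Fintype.card (QReg m) * Fintype.card (QReg m))) := by
  classical
  have hnd : (l.map (cell B h)).Nodup :=
    List.pairwise_map.2 (hfar.imp fun hXY => cell_ne_of_le_fro hh hXY)
  have hsub : (l.map (cell B h)).toFinset ⊆ cellBox m B h := fun c hc => by
    rw [List.mem_toFinset, List.mem_map] at hc
    obtain ⟨X, hX, rfl⟩ := hc
    exact cell_mem_cellBox hh (hbd X hX)
  calc l.length = (l.map (cell B h)).length := (List.length_map _).symm
    _ = (l.map (cell B h)).toFinset.card := (List.toFinset_card_of_nodup hnd).symm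
    _ ≤ (cellBox m B h).card := Finset.card_le_card hsub
    _ = _ := card_cellBox B h hB

end NetCompiler

end Literature.Computability.QuantumComplexity

end
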